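/-
Origin: expansion seat `planner-pub-hodgecm-mc-theta-3-g28-0`, handover #S15r2 2026-08-21T01:50Z md5 7f2ab5cbd226 (341 l.; REPLACE of the RUN-69 r1 d947f4f26e98 (NEW if RUN 69 dropped it); import HodgeCM.Model.LiuDictionaryPin only; NEW THEOREM NAMES for audit: HodgeCM.Model.LiuIndex.exists_lineOf_eq_ofCM · HodgeCM.Model.LiuIndex.GramClass.injective_of_mk_comp · HodgeCM.Model.LiuIndex.GramClass.mk_surjective; surviving audited r1 names re-certified in place) (`HOME/mc/pub-hodgecm-mc-theta-3-g28/stage70/HodgeCM/Model/LiuIndexPin.lean`, md5 7f2ab5cbd226, 341 lines);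
landed by the second packager p2 gen 17 (p2-g17) in gate run 70 REPLACES the earlier landed copy of `HodgeCM/Model/LiuIndexPin.lean` (verbatim).
-/
/-
Origin: THETA seat `planner-pub-hodgecm-mc-theta-3-g28-0` (unit pub-hodgecm-mc-theta-3-g28, gen 28 of mc-theta-3: theta supply ∕ second-lift ∕ see-saw lane),
2026-08-21.  r2 (RUN 70; REPLACES the RUN-69 r1 d947f4f26e98): the index terms made GENERIC IN THE REPRESENTATIVE SECTION `ρ`
(binder-2-g19 SEAM NOTE 2, STATUS l.14912: the junction POINTS the transversal at the slot scalar, `ρ := LiuIndex.repAt a₀` of #103).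
Target in PKG: `HodgeCM/Model/LiuIndexPin.lean` (additive KERNEL leaf beside E; imports binder-2 #102 `Model/LiuDictionaryPin` (RUN 69) and hence
#99–#101 (RUN 68); imported only by theta-3's `Model/LiuIndexCentralType`; outside E's import closure; E ∕ «A» untouched; MODEL-N ±0).
KERNEL ONLY: the INDEX TERMS of the pinned Liu dictionary — Gram-line classes, representative SECTIONS, the index type `IOf V ρ P` and the
index-line map `lineOf V ρ P` (injective for every injective `ρ`) — GENERIC in the section `ρ` and in ONE scalar-level type predicate `P`.
0 records, nothing cited, 0 `def … : Prop` asserted (the predicate is a PARAMETER). Nothing here is a claim of the manuscripts under adjudication.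
-/
import Summits.HodgeConjecture.HodgeCM.Model.LiuDictionaryPin

set_option autoImplicit false

/-!
# (J3 ∕ K0) THE PIN'S INDEX TERMS — `LiuIndex.GramClass L`, `LiuIndex.IOf V ρ P`, `LiuIndex.lineOf V ρ P` (r2: section-generic)

The junction-form E «ATp» (binder-2-g19) carries two DATA slots the theta lane was asked to TYPE (STATUS l.14859 ∕ l.14880):
the index `I` of the pinned dictionary `liuDictionaryPin … V I line` (#102) and its index lines `line : I → SplitLineE V`.  What the
index must be is fixed by the READ of [Liu21, Prop. 4.13] recorded in `mc/pub-hodgecm-mc-theta-3-g27/notes/I-ENUM-READ.g27.md`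
(E1)–(E3): the direct sum there runs over ALL adèlic oscillator triples `(μ, ε, χ)` with `μ` of weight one and `ε` `μ`-admissible — so,
in record currency and with the family form `Char := I`, `Adm i := {χ ∕∕ GoodChar}` of #102, the index lines must enumerate

* every Gram-line class `[a] ∈ L₀ˣ ∕ N(Lˣ)` (`ε`; admissibility then FORCES `Φ_μ = Φ^δ(a)`, [Liu21, Def. 4.12]) with ONE representative
  and ONE enumeration `e` per class (K0 RIDER 2 (i): records differing by a rescaling inside the class or by `e` are redundant), and
* for each class, every COMPATIBLE pair splitting `s` of the CM datum of that line whose `V`-character `μ_s` is «of weight one with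
  `Φ_{μ_s} = Φ^δ(a)`» — ALL of them, NO quotient by central twists ((E3): by [GR91, §3.1 Remark p. 457] the compatible splittings form ONE
  orbit `s ↦ s ⊗ ĉ`, distinct splittings ↔ distinct `μ`, so a quotient would delete Liu's sum over `μ`).

WHICH representative per class is immaterial to the five cited sentences of #102 (they hold for every transversal), but it matters to
the junction: the slot records of sinst-1 (#1254 ∕ #1256 `splitLineOne ∕ splitLineZeroTwisted`) sit at the slot's OWN scalar `a_k`, and
the index cannot depend on the context `c`.  binder-2-g19's SEAM NOTE 2 (l.14912) resolves this WITHOUT any transport of Weil modules: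
POINT the transversal at the slot scalar per call of the junction (`LiuIndex.repAt a₀`, #103 §0: the class of `a₀` is represented by `a₀`
itself).  Accordingly (r2) everything below is GENERIC IN A REPRESENTATIVE SECTION `ρ : GramClass L → RealScalar L`; the laws a consumer
needs are the hypotheses of the two theorems that use them (`lineOf_injective` ← `Injective ρ`, `lineOf_isometric_iff` ← `∀ q, mk (ρ q) = q`),
both supplied by #103 (`repAt_injective`, `repAt_spec`) for the pointed section and by `rep_injective ∕ mk_rep` for `ρ := rep = Quotient.out`.

This file supplies exactly those TERMS:

* §1 `LiuIndex.RealScalar L` (non-zero conj-fixed scalars; `RealScalar.vec a := lineVec L a` with `vec_real ∕ vec_ne`), the ISOMETRY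
  setoid «`b = z·z̄·a` for some `z ≠ 0`» (the clause shape of #100 ∕ #102 `hsmall_of_pin_at_of_isometric`), `LiuIndex.GramClass L`,
  `GramClass.mk`, the section `GramClass.rep := Quotient.out` (`mk_rep`, `rep_injective`, `rep_mk_equiv`), and for ANY section `ρ`:
  `GramClass.scalar ρ q := (ρ q).1`, `dW ρ q := RealScalar.vec (ρ q)`, `injective_of_mk_comp`, `eq_of_scalar_eq`, `mk_comp_equiv`;
* §2 over `V : HermSpace3 L ι₁`, enumeration FIXED to `e₁` (sinst-1's row enumeration of record, `Model/ArchSideTerm`), at SCALAR level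
  (so a slot owner states them at its own scalar with no cast): the type `SplittingAt V a` of pair splittings of the CM datum
  `cmSplittingDatum L e₁ (frameD V) … (RealScalar.vec a) …`, its compatibility predicate `IsCompatAtScalar V a` ([GR91, Prop. 3.1.1] by
  DEFINITION `IsCompatible`), the class-positioned aliases `PairSplittingAt V ρ q := SplittingAt V (ρ q)`, `IsCompatAt V ρ q`; and —
  GENERIC in a scalar-level predicate `P a s` — the index `IOf V ρ P := Σ q, {s : SplittingAt V (ρ q) ∕∕ IsCompatAtScalar V (ρ q) s ∧ P (ρ q) s}`
  with `lineOf V ρ P i := SplitLineE.ofCM V e₁ (RealScalar.vec (ρ i.1)) … i.2.1 …` (#102's index line of record), `lineOf_scalar`,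
  `lineOf_lineType = Φ^δ(scalar)`, `lineOf_injective`, `lineOf_isometric_iff`, and the POINTED CONSTRUCTOR `exists_lineOf_eq_ofCM`:
  from `ρ q = a` and a compatible `s` at `a` with `P a s`, an index `i` over `q` with `lineOf V ρ P i = SplitLineE.ofCM V e₁ (vec a) … s …`
  — an `Eq` of `SplitLineE V` records, the input of #103 §2 `mem_biSup_block_pin_of_line_eq`.

THE ONE SLOT LEFT OPEN, on purpose: `P a s` = «`μ_s` is conjugate-symplectic OF WEIGHT ONE [Liu21, Def. 4.2] with `Φ_{μ_s} = Φ^δ(a)`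
[Def. 4.12]», read at the archimedean centre: theta-3's `Model/LiuIndexCentralType` supplies the reading `HasCentralTypeAt V a s m` and the pin
`I V ρ μ := IOf V ρ (CentralTypeIs V μ)` modulo ONE integer recipe `μ` (MODEL-N's COND row N-i1-match, ruled by its owners axioms-1 ∕ binder-2
and the desk — not asserted by the theta lane).  Every theorem below holds for every `ρ` and every `P`.
-/

noncomputable section

open NumberField
open Literature.AlgebraicGeometry.Motives (CMType)
open Literature.AlgebraicGeometry.ShimuraVarieties
open Literature.NumberTheory.Automorphic
open Literature.NumberTheory.Weil1964
open Literature.NumberTheory.GelbartRogawski1991 Literature.NumberTheory.GelbartRogawski1991.UnitaryDualPair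

namespace HodgeCM.Model

open HodgeCM.Model.ArchSideTerm (e₁)

namespace LiuIndex

/-! ## §1. Gram scalars of lines, their classes and representative sections -/

section Classes

variable (L : CMField)

/-- the non-zero `complexConj`-fixed scalars of the CM field `L` (Gram scalars of hermitian LINES over `L ∕ L₀`). [folklore] -/
def RealScalar : Type :=
  {a : (L : Type) // IsCMField.complexConj (L : Type) a = a ∧ a ≠ 0}

namespace RealScalar

variable {L}

/-- ISOMETRY of the hermitian lines `⟨a⟩ ≅ ⟨b⟩`: `b = z·z̄·a` for some `z ≠ 0` (the slot-clause shape of #100 ∕ #102). [folklore] -/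
def IsIsometric (a b : RealScalar L) : Prop :=
  ∃ z : (L : Type), z ≠ 0 ∧ b.1 = z * conjRingHomK L z * a.1

/-- (Ported verbatim from the HodgeCMPerL package; no docstring in the source.) -/
theorem IsIsometric.refl (a : RealScalar L) : IsIsometric a a :=
  ⟨1, one_ne_zero, by rw [map_one, one_mul, one_mul]⟩

/-- (Ported verbatim from the HodgeCMPerL package; no docstring in the source.) -/
theorem IsIsometric.symm {a b : RealScalar L} (h : IsIsometric a b) : IsIsometric b a := by
  obtain ⟨z, hz, h⟩ := h
  have hcz : conjRingHomK L z ≠ 0 := (map_ne_zero _).mpr hz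
  refine ⟨z⁻¹, inv_ne_zero hz, ?_⟩
  calc a.1 = (z⁻¹ * z) * ((conjRingHomK L z)⁻¹ * conjRingHomK L z) * a.1 := by
          rw [inv_mul_cancel₀ hz, inv_mul_cancel₀ hcz, one_mul, one_mul]
    _ = z⁻¹ * conjRingHomK L z⁻¹ * (z * conjRingHomK L z * a.1) := by rw [map_inv₀]; ring
    _ = z⁻¹ * conjRingHomK L z⁻¹ * b.1 := by rw [h]

/-- (Ported verbatim from the HodgeCMPerL package; no docstring in the source.) -/
theorem IsIsometric.trans {a b c : RealScalar L} (h₁ : IsIsometric a b) (h₂ : IsIsometric b c) : IsIsometric a c := by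
  obtain ⟨z, hz, h₁⟩ := h₁
  obtain ⟨w, hw, h₂⟩ := h₂
  refine ⟨w * z, mul_ne_zero hw hz, ?_⟩
  rw [h₂, h₁, map_mul]
  ring

/-- the isometry setoid on Gram scalars of lines. [folklore] -/
instance setoid : Setoid (RealScalar L) where
  r := IsIsometric
  iseqv := ⟨IsIsometric.refl, IsIsometric.symm, IsIsometric.trans⟩

/-- (Ported verbatim from the HodgeCMPerL package; no docstring in the source.) -/
theorem equiv_iff (a b : RealScalar L) : a ≈ b ↔ ∃ z : (L : Type), z ≠ 0 ∧ b.1 = z * conjRingHomK L z * a.1 :=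
  Iff.rfl


/-- the diagonal Gram VECTOR of the line `⟨a⟩`: `lineVec L a` (sinst-1-g10 l.14876: `lineVec`, never `![·]`). [folklore] -/
abbrev vec (a : RealScalar L) : Fin 1 → (L : Type) := lineVec (L : Type) a.1

/-- (Ported verbatim from the HodgeCMPerL package; no docstring in the source.) -/
theorem vec_real (a : RealScalar L) : ∀ i, IsCMField.complexConj (L : Type) (vec a i) = vec a i := fun _ => a.2.1

/-- (Ported verbatim from the HodgeCMPerL package; no docstring in the source.) -/
theorem vec_ne (a : RealScalar L) : ∀ i, vec a i ≠ 0 := fun _ => a.2.2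

/-- (Ported verbatim from the HodgeCMPerL package; no docstring in the source.) -/
@[simp] theorem vec_zero (a : RealScalar L) : vec a 0 = a.1 := rfl

/-- the `conjRingHomK` spelling of realness (`conjRingHomK L = complexConj L`, `rfl`). [folklore] -/
theorem conj_val (a : RealScalar L) : conjRingHomK L a.1 = a.1 := a.2.1

end RealScalar

/-- **the classes of hermitian lines over `L ∕ L₀`** (`L₀ˣ ∕ N(Lˣ)` as a set): Gram scalars modulo isometry — the `ε`-coordinate
([Liu21, Def. 4.11 ∕ 4.12]: a `μ`-admissible `ε` IS a global line class) of the index of [Liu21, Prop. 4.13]. [folklore] -/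
def GramClass : Type :=
  Quotient (RealScalar.setoid (L := L))

namespace GramClass

variable {L}

/-- the class of a Gram scalar. [folklore] -/
def mk (a : RealScalar L) : GramClass L := Quotient.mk _ a

/-- (Ported verbatim from the HodgeCMPerL package; no docstring in the source.) -/
theorem mk_eq_mk_iff (a b : RealScalar L) : mk a = mk b ↔ a ≈ b := Quotient.eq

/-- (Ported verbatim from the HodgeCMPerL package; no docstring in the source.) -/
theorem mk_surjective : Function.Surjective (mk (L := L)) := Quotient.mk_surjective

/-- the DEFAULT representative section `Quotient.out` (r1's representative of record; the junction uses the POINTED section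
`LiuIndex.repAt a₀` of #103 instead — every statement below is generic in the section). [folklore] -/
def rep (q : GramClass L) : RealScalar L := Quotient.out q

/-- (Ported verbatim from the HodgeCMPerL package; no docstring in the source.) -/
@[simp] theorem mk_rep (q : GramClass L) : mk (rep q) = q := Quotient.out_eq q

/-- (Ported verbatim from the HodgeCMPerL package; no docstring in the source.) -/
theorem rep_injective : Function.Injective (rep (L := L)) := fun q q' h => by
  rw [← mk_rep q, ← mk_rep q', h]

/-- the default representative of the class of `a` is isometric to `a`. [folklore] -/
theorem rep_mk_equiv (a : RealScalar L) : rep (mk a) ≈ a := Quotient.exact (mk_rep (mk a))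

/-! ### Any representative SECTION `ρ` -/

variable (ρ : GramClass L → RealScalar L)

/-- a section of `mk` is injective. [folklore] -/
theorem injective_of_mk_comp (hρ : ∀ q, mk (ρ q) = q) : Function.Injective ρ := fun q q' h => by
  rw [← hρ q, ← hρ q', h]

/-- a section of `mk` picks, over the class of `a`, a scalar isometric to `a`. [folklore] -/
theorem mk_comp_equiv (hρ : ∀ q, mk (ρ q) = q) (a : RealScalar L) : ρ (mk a) ≈ a := Quotient.exact (hρ (mk a))

/-- the Gram scalar a section assigns to a class. [folklore] -/
def scalar (q : GramClass L) : (L : Type) := (ρ q).1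

/-- (Ported verbatim from the HodgeCMPerL package; no docstring in the source.) -/
theorem scalar_def (q : GramClass L) : scalar ρ q = (ρ q).1 := rfl

/-- (Ported verbatim from the HodgeCMPerL package; no docstring in the source.) -/
theorem scalar_real (q : GramClass L) : IsCMField.complexConj (L : Type) (scalar ρ q) = scalar ρ q := (ρ q).2.1

/-- the same in `conjRingHomK` spelling. [folklore] -/
theorem conj_scalar (q : GramClass L) : conjRingHomK L (scalar ρ q) = scalar ρ q := (ρ q).2.1

/-- (Ported verbatim from the HodgeCMPerL package; no docstring in the source.) -/
theorem scalar_ne (q : GramClass L) : scalar ρ q ≠ 0 := (ρ q).2.2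

variable {ρ} in
/-- (Ported verbatim from the HodgeCMPerL package; no docstring in the source.) -/
theorem eq_of_scalar_eq (hρ : Function.Injective ρ) {q q' : GramClass L} (h : scalar ρ q = scalar ρ q') : q = q' :=
  hρ (Subtype.ext h)

variable {ρ} in
/-- (Ported verbatim from the HodgeCMPerL package; no docstring in the source.) -/
theorem scalar_injective (hρ : Function.Injective ρ) : Function.Injective (scalar ρ) := fun _ _ => eq_of_scalar_eq hρ

/-- the diagonal Gram VECTOR a section assigns to a class: `RealScalar.vec (ρ q) = lineVec L (scalar ρ q)`. [folklore] -/
abbrev dW (q : GramClass L) : Fin 1 → (L : Type) := RealScalar.vec (ρ q)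

/-- (Ported verbatim from the HodgeCMPerL package; no docstring in the source.) -/
theorem dW_real (q : GramClass L) : ∀ i, IsCMField.complexConj (L : Type) (dW ρ q i) = dW ρ q i := RealScalar.vec_real (ρ q)

/-- (Ported verbatim from the HodgeCMPerL package; no docstring in the source.) -/
theorem dW_ne (q : GramClass L) : ∀ i, dW ρ q i ≠ 0 := RealScalar.vec_ne (ρ q)

/-- (Ported verbatim from the HodgeCMPerL package; no docstring in the source.) -/
@[simp] theorem dW_zero (q : GramClass L) : dW ρ q 0 = scalar ρ q := rfl

end GramClass

end Classes

/-! ## §2. Splittings at a scalar, the index and its lines over `V` — generic in the section `ρ` and the type predicate `P` -/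

section Index

variable {L : CMField} {ι₁ : (L : Type) →+* ℂ} (V : HermSpace3 L ι₁)

/-- the type of PAIR SPLITTINGS of the CM see-saw datum of the line `⟨a⟩` over the frame of record of `V`, enumeration `e₁`:
homs `U(diagonal (frameD V))(𝔸) × U(diagonal (vec a))(𝔸) →* M̃p` (the `s`-argument type of #102 `SplitLineE.ofCM V e₁ (vec a) …`). [folklore] -/
abbrev SplittingAt (a : RealScalar L) : Type :=
  UnitaryGroup.adelicPair (↥(maximalRealSubfield (L : Type))) (L : Type) (IsCMField.complexConj (L : Type)) 3 1
      (Matrix.diagonal (frameD V)) (Matrix.diagonal (RealScalar.vec a)) →*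
    adelicMpCont (↥(maximalRealSubfield (L : Type))) (Fin 3)
      (adelicGram (↥(maximalRealSubfield (L : Type))) e₁ (realDiagonal (L : Type) (frameD V) (frameD_real V))
        (realDiagonal (L : Type) (RealScalar.vec a) (RealScalar.vec_real a)))

/-- compatibility ([GR91, Prop. 3.1.1], by DEFINITION `IsCompatible`) of a pair splitting at the scalar `a`. [folklore] -/
abbrev IsCompatAtScalar (a : RealScalar L) (s : SplittingAt V a) : Prop :=
  (cmSplittingDatum (L : Type) e₁ (frameD V) (frameD_real V) (frameD_ne V)
      (RealScalar.vec a) (RealScalar.vec_real a) (RealScalar.vec_ne a)).IsCompatible s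

variable (ρ : GramClass L → RealScalar L)

/-- pair splittings at the class `q`, POSITIONED by the section `ρ` (`= SplittingAt V (ρ q)`, reducibly). [folklore] -/
abbrev PairSplittingAt (q : GramClass L) : Type := SplittingAt V (ρ q)

/-- compatibility at the class `q`, positioned by `ρ`. [folklore] -/
abbrev IsCompatAt (q : GramClass L) (s : PairSplittingAt V ρ q) : Prop := IsCompatAtScalar V (ρ q) s

variable (P : ∀ a : RealScalar L, SplittingAt V a → Prop)

/-- **THE INDEX over `V`, generic in the section `ρ` and the scalar-level type predicate `P`**: pairs (line class `q`, compatible pair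
splitting `s` at the scalar `ρ q` with `P (ρ q) s`).  With `P a s :=` «`μ_s` of weight one with `Φ_{μ_s} = Φ^δ(a)`» ([Liu21, Def. 4.2 ∕ 4.12])
and #102's `Adm i := {χ ∕∕ GoodChar}`, `Σ i : IOf V ρ P, Adm i` is the triple index of [Liu21, Prop. 4.13]: ALL `(μ, ε, χ)`, ONE Gram
representative (`ρ q`) and one enumeration per line class, no quotient by central twists. [folklore] -/
def IOf : Type :=
  Σ q : GramClass L, {s : SplittingAt V (ρ q) // IsCompatAtScalar V (ρ q) s ∧ P (ρ q) s}

namespace IOf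

variable {V ρ P}

/-- the line class of an index. [folklore] -/
abbrev cls (i : IOf V ρ P) : GramClass L := i.1

/-- the pair splitting of an index. [folklore] -/
abbrev splitting (i : IOf V ρ P) : SplittingAt V (ρ i.cls) := i.2.1

/-- (Ported verbatim from the HodgeCMPerL package; no docstring in the source.) -/
theorem isCompat (i : IOf V ρ P) : IsCompatAtScalar V (ρ i.cls) i.splitting := i.2.2.1

/-- (Ported verbatim from the HodgeCMPerL package; no docstring in the source.) -/
theorem prop (i : IOf V ρ P) : P (ρ i.cls) i.splitting := i.2.2.2

/-- constructor. [folklore] -/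
abbrev mk (q : GramClass L) (s : SplittingAt V (ρ q)) (hs : IsCompatAtScalar V (ρ q) s) (hP : P (ρ q) s) : IOf V ρ P :=
  ⟨q, s, hs, hP⟩

/-- (Ported verbatim from the HodgeCMPerL package; no docstring in the source.) -/
@[simp] theorem mk_fst (q : GramClass L) (s : SplittingAt V (ρ q)) (hs : IsCompatAtScalar V (ρ q) s) (hP : P (ρ q) s) :
    (mk q s hs hP).1 = q := rfl

end IOf

/-- **THE INDEX LINES**: `i ↦` #102's index line of record `SplitLineE.ofCM V e₁ (vec (ρ i.cls)) … i.splitting …` — W-fields LITERALLY the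
`cmSplittingDatum` constants at the scalar `ρ i.cls`, so #S14's `weilCoinv`, the sockets #99–#103 and the distribution side elaborate against
one term. [folklore] -/
def lineOf (i : IOf V ρ P) : SplitLineE V :=
  SplitLineE.ofCM V e₁ (RealScalar.vec (ρ i.1)) (RealScalar.vec_real (ρ i.1)) (RealScalar.vec_ne (ρ i.1)) i.2.1 i.2.2.1

/-- (Ported verbatim from the HodgeCMPerL package; no docstring in the source.) -/
theorem lineOf_def (i : IOf V ρ P) :
    lineOf V ρ P i =
      SplitLineE.ofCM V e₁ (RealScalar.vec (ρ i.1)) (RealScalar.vec_real (ρ i.1)) (RealScalar.vec_ne (ρ i.1)) i.2.1 i.2.2.1 := rfl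

/-- the Gram scalar of an index line is the scalar its section assigns to its class. [folklore] -/
@[simp] theorem lineOf_scalar (i : IOf V ρ P) : (lineOf V ρ P i).scalar = GramClass.scalar ρ i.1 :=
  SplitLineE.ofCM_scalar V e₁ _ _ _ _ _

/-- the line type of an index line is `Φ^δ(scalar)` of its class. [folklore] -/
theorem lineOf_lineType (i : IOf V ρ P) :
    (lineOf V ρ P i).lineType =
      SignRecipe.lineType (GramClass.scalar ρ i.1) (GramClass.conj_scalar ρ i.1) (GramClass.scalar_ne ρ i.1) :=
  SplitLineE.ofCM_lineType V e₁ _ _ _ _ _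

/-- the pair splitting of an index line is the index's splitting (by `rfl`). [folklore] -/
theorem lineOf_s (i : IOf V ρ P) : (lineOf V ρ P i).s = i.2.1 := rfl

variable {ρ} in
/-- **K0: the index-line map is INJECTIVE** for an injective section — one representative per class, and `ofCM` remembers the splitting.
[folklore] -/
theorem lineOf_injective (hρ : Function.Injective ρ) : Function.Injective (lineOf V ρ P) := by
  rintro ⟨q, s, hs⟩ ⟨q', s', hs'⟩ h
  have hsc : GramClass.scalar ρ q = GramClass.scalar ρ q' :=
    ((lineOf_scalar V ρ P ⟨q, s, hs⟩).symm.trans (congrArg (fun p : SplitLineE V => p.scalar) h)).trans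
      (lineOf_scalar V ρ P ⟨q', s', hs'⟩)
  obtain rfl : q = q' := GramClass.eq_of_scalar_eq hρ hsc
  have hss : HEq (lineOf V ρ P ⟨q, s, hs⟩).s (lineOf V ρ P ⟨q, s', hs'⟩).s :=
    (Sigma.mk.inj_iff.mp (congrArg (fun p : SplitLineE V =>
      (⟨p.toHermLineDatum, p.s⟩ :
        Σ ℓ : HermLineDatum L, PairSplitting (Matrix.diagonal (frameD V)) (realDiagonal (L : Type) (frameD V) (frameD_real V)) ℓ)) h)).2
  obtain rfl : s = s' := eq_of_heq hss
  rfl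

variable {ρ} in
/-- two indices with the same line have the same class. [folklore] -/
theorem cls_eq_of_lineOf_eq (hρ : Function.Injective ρ) {i j : IOf V ρ P} (h : lineOf V ρ P i = lineOf V ρ P j) : i.1 = j.1 :=
  congrArg Sigma.fst (lineOf_injective V P hρ h)

variable {ρ} in
/-- index lines in DIFFERENT classes have DIFFERENT Gram scalars (for an injective section). [folklore] -/
theorem lineOf_scalar_ne (hρ : Function.Injective ρ) {i j : IOf V ρ P} (h : i.1 ≠ j.1) :
    (lineOf V ρ P i).scalar ≠ (lineOf V ρ P j).scalar := by
  rw [lineOf_scalar, lineOf_scalar]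
  exact fun hs => h (GramClass.eq_of_scalar_eq hρ hs)

variable {ρ} in
/-- the slot clause of #100 ∕ #102 («`∃ z ≠ 0, (line j).scalar = z·z̄·a`») holds for an index line iff its class is the class of `a`
(for a section of `mk`). [folklore] -/
theorem lineOf_isometric_iff (hρ : ∀ q, GramClass.mk (ρ q) = q) (i : IOf V ρ P) (a : RealScalar L) :
    (∃ z : (L : Type), z ≠ 0 ∧ (lineOf V ρ P i).scalar = z * conjRingHomK L z * a.1) ↔ i.1 = GramClass.mk a := by
  rw [lineOf_scalar, ← hρ i.1, GramClass.mk_eq_mk_iff, hρ]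
  exact (RealScalar.equiv_iff a (ρ i.1)).symm.trans ⟨Setoid.symm, Setoid.symm⟩

variable {ρ P} in
/-- **THE POINTED CONSTRUCTOR** (binder-2-g19 SEAM NOTE 2): if the section puts the scalar `a` itself over the class `q` (`ρ q = a`; for
`ρ := LiuIndex.repAt a`, `q := mk a` this is #103 `repAt_mk_self`), then a compatible splitting `s` AT `a` with `P a s` is an index over `q`
whose line is `SplitLineE.ofCM V e₁ (vec a) … s …` ON THE NOSE — an `Eq` of records, the input of #103 §2 `mem_biSup_block_pin_of_line_eq`;
no transport of Weil modules, no cast for the caller. [folklore] -/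
theorem exists_lineOf_eq_ofCM {q : GramClass L} {a : RealScalar L} (h : ρ q = a) (s : SplittingAt V a)
    (hs : IsCompatAtScalar V a s) (hP : P a s) :
    ∃ i : IOf V ρ P, i.1 = q ∧
      lineOf V ρ P i = SplitLineE.ofCM V e₁ (RealScalar.vec a) (RealScalar.vec_real a) (RealScalar.vec_ne a) s hs := by
  subst h
  exact ⟨⟨q, s, hs, hP⟩, rfl, rfl⟩

end Index

end LiuIndex

end HodgeCM.Model
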